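import Mathlib.Algebra.MonoidAlgebra.Basic
import Mathlib.Algebra.BigOperators.Ring.Finset
import Mathlib.Algebra.Order.BigOperators.Group.Finset
import Mathlib.Algebra.CharP.Lemmas
import Mathlib.Algebra.CharP.Algebra
import Mathlib.Data.Fintype.BigOperators
import Mathlib.FieldTheory.Finite.Basic
import Mathlib.GroupTheory.OrderOfElement
import Mathlib.Tactic.Ring
import Mathlib.Tactic.Linarith
import Mathlib.Tactic.Abel
import Mathlib.Tactic.NormNum
import Mathlib.Tactic.Positivity
import HarnessLib

/-!
# Difference sets in finite abelian groups and Hall's First Multiplier Theorem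

Literature formalisation (cell `pub-namedobj`, target M: it puts the census control B2 'no cyclic projective
plane of order 12' into the kernel, see `Summits/Ventures/DiscreteObjects/PP12/NoOrder157.lean`), in the
vocabulary of a finite additive commutative group `G` (Mathlib `AddCommGroup` + `Fintype`) and of Mathlib's
group ring `AddMonoidAlgebra R G`.

* `IsDifferenceSet D λ` — `D ⊆ G` is a `(v, k, λ)` difference set, `v = |G|`, `k = |D|`: every non-zero
  `g ∈ G` has exactly `λ` representations `g = a - b`, `a, b ∈ D` [Lander 1983, §4.1]. We count the
  representations by their second coordinate, `#{b ∈ D | g + b ∈ D} = λ`; `card_pairs_eq` is the pair form.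
* `chi R S = Σ_{s ∈ S} [s]`, `chiNeg R S = Σ_{s ∈ S} [-s]`, `whole R = Σ_{g ∈ G} [g]` and the augmentation
  `aug` (private coefficient calculus behind them), and the **group-ring form of the definition**
  `χ_D χ_D^(-1) = (k - λ) + λ G` (`chi_mul_chiNeg_self`) [Lander 1983, §4.1].
* `IsDifferenceSet.basic_eq` — the parameter relation `λ(v - 1) = k(k - 1)`, PROVED; translates
  (`image_add_right`) and images under automorphisms of `G` (`image_of_injective`) are difference sets with
  the same `λ`.
* **`IsDifferenceSet.multiplier` — Hall's First Multiplier Theorem** [Lander 1983, Thm. 5.3; Hall 1947 for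
  cyclic planar difference sets; Hall–Ryser 1951 for general `λ`]: if `D` is a `(v,k,λ)` difference set in a
  finite abelian group, `n = k - λ > 0`, and `p` is a prime with `p ∣ n`, `p ∤ v`, `p > λ`, then
  `p·D = D + s` for some `s ∈ G` (`p` is a numerical multiplier). PROVED, by the elementary group-ring
  argument: with `E = χ_{pD} χ_D^(-1) ∈ ℤ[G]`, Frobenius in `𝔽_p[G]` gives `χ_{pD} = χ_D^p`, hence
  `E ≡ χ_D^{p-1}(n + λG) ≡ λ k^{p-1} G ≡ λG (mod p)`, so `E = λG + pR` with `R ≥ 0` and `Σ R = n/p =: m`;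
  comparing the coefficient at `0` of `E E^(-1) = (χ_D χ_D^(-1))(χ_{pD} χ_{pD}^(-1))` gives `Σ R² = m²`, so
  `R = m·[s]` for one `s`, `E(s) = λ + n = k`, i.e. `D + s ⊆ pD`, and both sets have `k` elements.
* `exists_translate_sum_eq_zero`, `image_nsmul_eq_self_of_sum_eq_zero` [Lander 1983, Thm. 5.10 and its
  proof]: when `gcd(k, v) = 1` some translate of `D` has element-sum `0`, and that translate is FIXED by
  every numerical multiplier. These are the two ingredients of the classical non-existence arguments
  'p is a multiplier but no union of orbits of x ↦ px has k elements' [Lander 1983, Table 5-1].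

Everything here is proved; no `sorry`, no new axioms.

## References
* E. S. Lander, *Symmetric Designs: An Algebraic Approach*, LMS Lecture Note Series 74, Cambridge University
  Press 1983, doi:10.1017/cbo9780511662164: §4.1 (difference sets, the group-ring equation `D D^(-1) = n + λG`),
  §4.2 (multipliers), Thm. 5.3 (First Multiplier Theorem), Thm. 5.10, Table 5-1. Held copy: corpus
  `book:lander1983-symmetric-designs-algebraic-approach`; page locators below are chunk numbers of the held
  copy. [Lander1983]
* M. Hall, Jr., *Cyclic projective planes*, Duke Math. J. 14 (1947) 1079–1090,
  doi:10.1215/S0012-7094-47-01482-8 (`λ = 1`, cyclic groups). [Hall1947CyclicProjectivePlanes]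
* M. Hall, Jr., H. J. Ryser, *Cyclic incidence matrices*, Canad. J. Math. 3 (1951) 495–502,
  doi:10.4153/CJM-1951-051-8 (general `λ`, `p > λ`). [HallRyser1951CyclicIncidenceMatrices]
-/

namespace Literature.Combinatorics.Designs.DifferenceSets

open Finset

variable {G : Type*} [AddCommGroup G] [Fintype G] [DecidableEq G]

/-- `D` is a `(v, k, λ)` difference set in the finite abelian group `G` (written additively), with
`v = |G|`, `k = |D|`: every non-zero `g : G` has exactly `λ` representations `g = a - b` with `a, b ∈ D`;
we count them by the second coordinate, `#{b ∈ D | g + b ∈ D} = λ` (see `card_pairs_eq` for the pair form).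
[cite: Lander1983, §4.1 Definition p. 111] -/
def IsDifferenceSet (D : Finset G) (lam : ℕ) : Prop :=
  ∀ g : G, g ≠ 0 → (D.filter fun b => g + b ∈ D).card = lam

/-- number of representations `x = a - b`, `a ∈ A`, `b ∈ B`, counted by `b`: `#{b ∈ B | x + b ∈ A}`. [folklore] -/
def repCount (A B : Finset G) (x : G) : ℕ := (B.filter fun b => x + b ∈ A).card

omit [Fintype G] in
/-- The pair form of the representation count, `#{(a,b) ∈ A × B | a - b = x} = #{b ∈ B | x + b ∈ A}`: with `A = B = D`
this is the count of the textbook definition ('every non-identity element has exactly `λ` representations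
`d₁ d₂⁻¹`'). [cite: Lander1983, §4.1 Definition p. 111] -/
theorem card_pairs_eq (A B : Finset G) (x : G) :
    ((A ×ˢ B).filter fun ab : G × G => ab.1 - ab.2 = x).card = repCount A B x := by
  unfold repCount
  refine Finset.card_bij' (fun ab _ => ab.2) (fun b _ => (x + b, b)) ?_ ?_ ?_ ?_
  · intro ab hab
    simp only [mem_filter, mem_product] at hab ⊢
    obtain ⟨⟨ha, hb⟩, hx⟩ := hab
    refine ⟨hb, ?_⟩
    have : x + ab.2 = ab.1 := by rw [← hx]; abel
    rw [this]; exact ha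
  · intro b hb
    simp only [mem_filter, mem_product] at hb ⊢
    exact ⟨⟨hb.2, hb.1⟩, by abel⟩
  · intro ab hab
    simp only [mem_filter, mem_product] at hab
    obtain ⟨-, hx⟩ := hab
    ext
    · simp only; rw [← hx]; abel
    · rfl
  · intro b _; rfl

omit [Fintype G] in
/-- symmetry of the representation count: `#{b ∈ B | x + b ∈ A} = #{a ∈ A | -x + a ∈ B}`. [folklore] -/
private theorem repCount_swap (A B : Finset G) (x : G) : repCount A B x = repCount B A (-x) := by
  unfold repCount
  refine Finset.card_bij' (fun b _ => x + b) (fun a _ => -x + a) ?_ ?_ ?_ ?_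
  · intro b hb
    simp only [mem_filter] at hb ⊢
    refine ⟨hb.2, ?_⟩
    have : -x + (x + b) = b := by abel
    rw [this]; exact hb.1
  · intro a ha
    simp only [mem_filter] at ha ⊢
    refine ⟨ha.2, ?_⟩
    have : x + (-x + a) = a := by abel
    rw [this]; exact ha.1
  · intro b _; abel
  · intro a _; abel

omit [Fintype G] in
/-- at `x = 0` the count is `|A ∩ B|`; in particular `repCount D D 0 = |D|`. [folklore] -/
private theorem repCount_self_zero (D : Finset G) : repCount D D 0 = D.card := by
  unfold repCount
  congr 1
  ext b
  simp

section GroupRing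

variable (R : Type*) [CommRing R]

/-- the indicator `χ_S = Σ_{s ∈ S} [s]` of a finite set in the group ring `R[G]` (Lander writes `S` for it).
[cite: Lander1983, §4.1 p. 113 (group-ring notation)] -/
noncomputable def chi (S : Finset G) : AddMonoidAlgebra R G := ∑ s ∈ S, AddMonoidAlgebra.single s 1

/-- the reversed indicator `χ_S^(-1) = Σ_{s ∈ S} [-s]` (Lander's `S^(-1)`). [cite: Lander1983, §4.1 p. 113 (group-ring notation)] -/
noncomputable def chiNeg (S : Finset G) : AddMonoidAlgebra R G :=
  ∑ s ∈ S, AddMonoidAlgebra.single (-s) 1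

/-- the all-one element `Σ_{g ∈ G} [g]` (Lander's `G`). [cite: Lander1983, §4.1 p. 113 (group-ring notation)] -/
noncomputable def whole : AddMonoidAlgebra R G := ∑ g : G, AddMonoidAlgebra.single g 1

/-- the augmentation (sum of coefficients) of an element of the group ring. [folklore] -/
noncomputable def aug (f : AddMonoidAlgebra R G) : R := ∑ g : G, f.coeff g

variable {R}

omit [DecidableEq G] in
/-- convolution formula for coefficients over a finite group. [folklore] -/
private theorem coeff_mul_fintype (f g : AddMonoidAlgebra R G) (x : G) :
    (f * g).coeff x = ∑ y : G, f.coeff y * g.coeff (x - y) := by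
  rw [AddMonoidAlgebra.coeff_mul_apply_left, Finsupp.sum_fintype]
  · refine Finset.sum_congr rfl fun y _ => ?_
    rw [neg_add_eq_sub]
  · intro y; simp

omit [AddCommGroup G] [Fintype G] in
/-- coefficients of `χ_S`. [folklore] -/
private theorem coeff_chi (S : Finset G) (y : G) : (chi R S).coeff y = if y ∈ S then 1 else 0 := by
  unfold chi
  rw [AddMonoidAlgebra.coeff_sum, Finsupp.finsetSum_apply]
  simp only [AddMonoidAlgebra.coeff_single, Finsupp.single_apply]
  rw [Finset.sum_ite_eq' S y (fun _ => (1 : R))]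

omit [Fintype G] in
/-- coefficients of `χ_S^(-1)`. [folklore] -/
private theorem coeff_chiNeg (S : Finset G) (y : G) : (chiNeg R S).coeff y = if -y ∈ S then 1 else 0 := by
  unfold chiNeg
  rw [AddMonoidAlgebra.coeff_sum, Finsupp.finsetSum_apply]
  simp only [AddMonoidAlgebra.coeff_single, Finsupp.single_apply]
  have : ∀ s ∈ S, (if -s = y then (1 : R) else 0) = if s = -y then 1 else 0 := by
    intro s _
    congr 1
    exact propext neg_eq_iff_eq_neg
  rw [Finset.sum_congr rfl this, Finset.sum_ite_eq' S (-y) (fun _ => (1 : R))]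

omit [AddCommGroup G] in
/-- coefficients of `T`. [folklore] -/
private theorem coeff_whole (y : G) : (whole R : AddMonoidAlgebra R G).coeff y = 1 := by
  unfold whole
  rw [AddMonoidAlgebra.coeff_sum, Finsupp.finsetSum_apply]
  simp only [AddMonoidAlgebra.coeff_single, Finsupp.single_apply]
  rw [Finset.sum_ite_eq' univ y (fun _ => (1 : R))]
  simp

omit [Fintype G] in
/-- coefficients of a natural-number constant. [folklore] -/
private theorem coeff_natCast (c : ℕ) (y : G) :
    ((c : AddMonoidAlgebra R G)).coeff y = if y = 0 then (c : R) else 0 := by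
  rw [AddMonoidAlgebra.natCast_def, AddMonoidAlgebra.coeff_single, Finsupp.single_apply]
  by_cases h : y = 0
  · subst h; simp
  · simp [h, Ne.symm h]

/-- coefficients of `c * f` for a natural number `c`. [folklore] -/
private theorem coeff_natCast_mul (c : ℕ) (f : AddMonoidAlgebra R G) (y : G) :
    ((c : AddMonoidAlgebra R G) * f).coeff y = (c : R) * f.coeff y := by
  rw [coeff_mul_fintype, Finset.sum_eq_single (0 : G)]
  · rw [coeff_natCast]; simp
  · intro b _ hb; rw [coeff_natCast, if_neg hb, zero_mul]
  · intro h; exact absurd (mem_univ _) h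

/-- **the key count**: the coefficient of `χ_A · χ_B^(-1)` at `x` is the number of representations
`x = a - b`. [folklore] -/
private theorem coeff_chi_mul_chiNeg (A B : Finset G) (x : G) :
    (chi R A * chiNeg R B).coeff x = (repCount A B x : R) := by
  rw [coeff_mul_fintype]
  have h1 : ∀ y : G, (chi R A).coeff y * (chiNeg R B).coeff (x - y) =
      if y ∈ A ∧ y - x ∈ B then 1 else 0 := by
    intro y
    rw [coeff_chi, coeff_chiNeg, neg_sub]
    by_cases ha : y ∈ A <;> by_cases hb : y - x ∈ B <;> simp [ha, hb]
  rw [Finset.sum_congr rfl fun y _ => h1 y, Finset.sum_boole]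
  unfold repCount
  congr 1
  refine Finset.card_bij' (fun y _ => y - x) (fun b _ => x + b) ?_ ?_ ?_ ?_
  · intro y hy
    simp only [mem_filter, mem_univ, true_and] at hy ⊢
    exact ⟨hy.2, by rw [add_sub_cancel]; exact hy.1⟩
  · intro b hb
    simp only [mem_filter, mem_univ, true_and] at hb ⊢
    exact ⟨hb.2, by rw [add_sub_cancel_left]; exact hb.1⟩
  · intro y _; exact add_sub_cancel x y
  · intro b _; exact add_sub_cancel_left x b

omit [DecidableEq G] in
/-- augmentation of a product. [folklore] -/
private theorem aug_mul (f g : AddMonoidAlgebra R G) : aug R (f * g) = aug R f * aug R g := by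
  unfold aug
  simp_rw [coeff_mul_fintype]
  rw [Finset.sum_comm, Finset.sum_mul]
  refine Finset.sum_congr rfl fun y _ => ?_
  rw [← Finset.mul_sum]
  congr 1
  exact (Equiv.subRight y).sum_comp (fun z => g.coeff z)

/-- augmentation of a power. [folklore] -/
private theorem aug_pow (f : AddMonoidAlgebra R G) (n : ℕ) : aug R (f ^ n) = aug R f ^ n := by
  induction n with
  | zero =>
    simp only [pow_zero]
    unfold aug
    rw [show (1 : AddMonoidAlgebra R G) = ((1 : ℕ) : AddMonoidAlgebra R G) by simp]
    simp_rw [coeff_natCast]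
    simp
  | succ n ih => rw [pow_succ, aug_mul, ih, pow_succ]

omit [AddCommGroup G] in
/-- augmentation of `χ_S` is `|S|`. [folklore] -/
private theorem aug_chi (S : Finset G) : aug R (chi R S) = (S.card : R) := by
  unfold aug
  simp_rw [coeff_chi]
  rw [Finset.sum_boole]
  simp

omit [AddCommGroup G] in
/-- augmentation of `T` is `|G|`. [folklore] -/
private theorem aug_whole : aug R (whole R : AddMonoidAlgebra R G) = (Fintype.card G : R) := by
  unfold aug
  simp_rw [coeff_whole]
  simp

/-- `f · T = aug(f) · T`. [folklore] -/
private theorem mul_whole (f : AddMonoidAlgebra R G) : f * whole R = aug R f • whole R := by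
  ext x
  rw [coeff_mul_fintype, AddMonoidAlgebra.coeff_smul, Finsupp.smul_apply, coeff_whole, smul_eq_mul,
    mul_one]
  unfold aug
  exact Finset.sum_congr rfl fun y _ => by rw [coeff_whole, mul_one]

/-- `f · T = c · T` when `aug f = c` is a natural number. [folklore] -/
private theorem mul_whole_of_aug_eq {f : AddMonoidAlgebra R G} {c : ℕ} (h : aug R f = c) :
    f * whole R = (c : AddMonoidAlgebra R G) * whole R := by
  rw [mul_whole, h, Nat.cast_smul_eq_nsmul, nsmul_eq_mul]

/-- `T · T = v · T`. [folklore] -/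
private theorem whole_mul_whole :
    (whole R : AddMonoidAlgebra R G) * whole R = (Fintype.card G : AddMonoidAlgebra R G) * whole R :=
  mul_whole_of_aug_eq aug_whole


omit [AddCommGroup G] in
/-- augmentation of a sum of singles. [folklore] -/
private theorem coeff_sum_single (c : G → R) (x : G) :
    (∑ y : G, AddMonoidAlgebra.single y (c y) : AddMonoidAlgebra R G).coeff x = c x := by
  rw [AddMonoidAlgebra.coeff_sum, Finsupp.finsetSum_apply]
  simp only [AddMonoidAlgebra.coeff_single, Finsupp.single_apply]
  rw [Finset.sum_ite_eq' univ x c]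
  simp

/-- augmentation of `χ_S^(-1)` is `|S|`. [folklore] -/
private theorem aug_chiNeg (S : Finset G) : aug R (chiNeg R S) = (S.card : R) := by
  unfold aug
  simp_rw [coeff_chiNeg]
  rw [Finset.sum_boole]
  congr 1
  rw [← Finset.card_map (Equiv.neg G).toEmbedding]
  congr 1
  ext y
  simp

/-- the **difference-set identity** in the group ring: `χ_D χ_D^(-1) = (k - λ) + λ T`.
[cite: Lander1983, §4.1 (group-ring form of the definition) p. 113] -/
theorem chi_mul_chiNeg_self {D : Finset G} {lam : ℕ} (hD : IsDifferenceSet D lam) (hle : lam ≤ D.card) :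
    chi R D * chiNeg R D =
      ((D.card - lam : ℕ) : AddMonoidAlgebra R G) + (lam : AddMonoidAlgebra R G) * whole R := by
  ext x
  rw [coeff_chi_mul_chiNeg, AddMonoidAlgebra.coeff_add, Finsupp.add_apply, coeff_natCast_mul, coeff_whole,
    coeff_natCast, mul_one]
  by_cases hx : x = 0
  · subst hx
    rw [repCount_self_zero, if_pos rfl, ← Nat.cast_add, Nat.sub_add_cancel hle]
  · rw [if_neg hx, zero_add]
    unfold repCount
    rw [hD x hx]

end GroupRing

namespace IsDifferenceSet

variable {D : Finset G} {lam : ℕ}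

/-- **The basic parameter relation** `λ (v - 1) = k (k - 1)` of a `(v,k,λ)` difference set.
[cite: Lander1983, §4.1 p. 111 (counting differences)] -/
theorem basic_eq (hD : IsDifferenceSet D lam) : lam * (Fintype.card G - 1) = D.card * (D.card - 1) := by
  classical
  -- augmentation of χ_D χ_D^(-1) computed two ways, in ℤ
  have h1 : aug ℤ (chi ℤ D * chiNeg ℤ D) = (D.card : ℤ) * D.card := by
    rw [aug_mul, aug_chi, aug_chiNeg]
  have h2 : aug ℤ (chi ℤ D * chiNeg ℤ D) = (D.card : ℤ) + lam * (Fintype.card G - 1 : ℕ) := by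
    unfold aug
    simp_rw [coeff_chi_mul_chiNeg]
    rw [← Finset.sum_erase_add _ _ (mem_univ (0 : G)), repCount_self_zero]
    have : ∀ x ∈ (univ : Finset G).erase 0, (repCount D D x : ℤ) = lam := by
      intro x hx
      unfold repCount
      rw [hD x (Finset.ne_of_mem_erase hx)]
    rw [Finset.sum_congr rfl this, Finset.sum_const, Finset.card_erase_of_mem (mem_univ _), Finset.card_univ,
      nsmul_eq_mul]
    ring
  have hv : 1 ≤ Fintype.card G := Fintype.card_pos
  have h3 : (lam : ℤ) * (Fintype.card G - 1 : ℕ) = (D.card : ℤ) * D.card - D.card := by linarith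
  rcases Nat.eq_zero_or_pos D.card with hk | hk
  · -- D empty: both sides vanish
    have : (lam : ℤ) * (Fintype.card G - 1 : ℕ) = 0 := by rw [h3, hk]; simp
    have h0 : lam * (Fintype.card G - 1) = 0 := by exact_mod_cast this
    rw [h0, hk]
  · have : ((D.card * (D.card - 1) : ℕ) : ℤ) = (D.card : ℤ) * D.card - D.card := by
      rw [Nat.cast_mul, Nat.cast_sub hk]; ring
    exact_mod_cast h3.trans this.symm

omit [Fintype G] in
/-- a translate of a difference set is a difference set. [cite: Lander1983, §4.1 p. 113 (translates)] -/
theorem image_add_right (hD : IsDifferenceSet D lam) (g : G) :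
    IsDifferenceSet (D.image fun x => x + g) lam := by
  intro x hx
  rw [← hD x hx]
  refine Finset.card_bij' (fun b _ => b - g) (fun b _ => b + g) ?_ ?_ ?_ ?_
  · intro b hb
    simp only [mem_filter, mem_image] at hb ⊢
    obtain ⟨⟨b', hb', rfl⟩, ⟨c, hc, hcx⟩⟩ := hb
    refine ⟨by simpa using hb', ?_⟩
    have : c = x + (b' + g - g) := by rw [add_sub_cancel_right, ← add_right_cancel_iff (a := g), hcx, add_assoc]
    rw [← this]; exact hc
  · intro b hb
    simp only [mem_filter, mem_image] at hb ⊢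
    exact ⟨⟨b, hb.1, rfl⟩, ⟨x + b, hb.2, by rw [add_assoc]⟩⟩
  · intro b _; exact sub_add_cancel b g
  · intro b _; exact add_sub_cancel_right b g

/-- the image of a difference set under an injective additive map `G → G` (an automorphism of the finite
group) is a difference set with the same `λ`. [cite: Lander1983, §4.2 p. 120 (automorphisms of G acting on
difference sets)] -/
theorem image_of_injective (hD : IsDifferenceSet D lam) (φ : G → G) (hadd : ∀ a b, φ (a + b) = φ a + φ b)
    (hinj : Function.Injective φ) : IsDifferenceSet (D.image φ) lam := by
  classical
  have hsurj : Function.Surjective φ := Finite.surjective_of_injective hinj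
  have h0 : φ 0 = 0 := by
    have := hadd 0 0
    rw [add_zero] at this
    exact left_eq_add.mp this
  intro x hx
  obtain ⟨x', rfl⟩ := hsurj x
  have hx' : x' ≠ 0 := by rintro rfl; exact hx h0
  rw [← hD x' hx', ← Finset.card_image_of_injective (D.filter fun b => x' + b ∈ D) hinj]
  congr 1
  ext b
  simp only [mem_filter, mem_image]
  constructor
  · rintro ⟨⟨b', hb', rfl⟩, hmem⟩
    refine ⟨b', ⟨hb', ?_⟩, rfl⟩
    rw [← hadd] at hmem
    obtain ⟨a, ha, hφa⟩ := hmem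
    exact hinj hφa ▸ ha
  · rintro ⟨b', ⟨hb', hmem⟩, rfl⟩
    refine ⟨⟨b', hb', rfl⟩, ?_⟩
    exact ⟨x' + b', hmem, by rw [hadd]⟩

omit [Fintype G] in
/-- a nonzero difference set with `λ = 0` is a single point. [folklore] -/
private theorem card_le_one_of_zero (hD : IsDifferenceSet D 0) : D.card ≤ 1 := by
  by_contra h
  rw [not_le, Finset.one_lt_card] at h
  obtain ⟨a, ha, b, hb, hab⟩ := h
  have hg : a - b ≠ 0 := sub_ne_zero.mpr hab
  have := hD (a - b) hg
  rw [Finset.card_eq_zero] at this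
  have hbmem : b ∈ D.filter fun c => a - b + c ∈ D := by
    rw [mem_filter]; exact ⟨hb, by rw [sub_add_cancel]; exact ha⟩
  rw [this] at hbmem
  exact absurd hbmem (Finset.notMem_empty b)

/-- **Hall's First Multiplier Theorem** (Hall 1947 for cyclic planar difference sets; Hall–Ryser 1951,
Chowla–Ryser; abelian form as in Lander). Let `D` be a `(v,k,λ)` difference set in the finite abelian group
`G`, `n = k - λ > 0`, and let `p` be a prime with `p ∣ n`, `p > λ` and `p ∤ v`. Then `p` is a (numerical)
multiplier of `D`: `p·D = D + s` for some `s ∈ G`. Our proof is the elementary group-ring argument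
(`χ_{pD} χ_D^(-1) ≡ λT (mod p)`, then a sum-of-squares comparison of `E E^(-1)` with `(n + λT)²`).
[cite: Lander1983, Thm. 5.3 (First Multiplier Theorem) p. 247] -/
theorem multiplier (hD : IsDifferenceSet D lam) {p : ℕ} (hp : p.Prime) (hlam : lam < p)
    (hn : lam < D.card) (hpn : p ∣ D.card - lam) (hpv : ¬ p ∣ Fintype.card G) :
    ∃ s : G, D.image (fun x => p • x) = D.image (fun x => x + s) := by
  classical
  haveI : Fact p.Prime := ⟨hp⟩
  -- (0) multiplication by `p` is an automorphism of `G`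
  have hinj : Function.Injective (fun x : G => p • x) := by
    intro a b hab
    have h0 : p • (a - b) = 0 := by rw [smul_sub]; exact sub_eq_zero.mpr hab
    have hord : addOrderOf (a - b) ∣ p := addOrderOf_dvd_of_nsmul_eq_zero h0
    have hcard : addOrderOf (a - b) ∣ Fintype.card G := addOrderOf_dvd_card
    have h1 : addOrderOf (a - b) = 1 := by
      rcases (Nat.dvd_prime hp).mp hord with h | h
      · exact h
      · exact absurd (h ▸ hcard) hpv
    exact sub_eq_zero.mp (AddMonoid.addOrderOf_eq_one_iff.mp h1)
  set pD := D.image (fun x => p • x) with hpD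
  have hpDcard : pD.card = D.card := Finset.card_image_of_injective _ hinj
  have hpD_ds : IsDifferenceSet pD lam := hD.image_of_injective _ (fun a b => smul_add p a b) hinj
  have hle : lam ≤ D.card := hn.le
  -- `p ∤ k`
  have hpk : ¬ p ∣ D.card := by
    intro hpk'
    have hpl : p ∣ lam := by
      have h := Nat.dvd_sub hpk' hpn
      rwa [Nat.sub_sub_self hle] at h
    have hl0 : lam = 0 := Nat.eq_zero_of_dvd_of_lt hpl hlam
    subst hl0
    have hk1 : D.card ≤ 1 := hD.card_le_one_of_zero
    have hk1' : D.card = 1 := by omega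
    rw [hk1'] at hpk'
    exact hp.one_lt.ne' (Nat.dvd_one.mp hpk')
  have hk0 : (D.card : ZMod p) ≠ 0 := by
    rw [Ne, ZMod.natCast_eq_zero_iff]; exact hpk
  -- (1) the congruence `E(x) ≡ λ (mod p)` for `E(x) = #{b ∈ D | x + b ∈ pD}`, via Frobenius in `𝔽_p[G]`
  have hmodp : ∀ x : G, (repCount pD D x : ZMod p) = (lam : ZMod p) := by
    intro x
    haveI hchar : CharP (AddMonoidAlgebra (ZMod p) G) p :=
      charP_of_injective_algebraMap (R := ZMod p) (A := AddMonoidAlgebra (ZMod p) G)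
        (fun a b hab => by simpa [AddMonoidAlgebra.coe_algebraMap] using hab) p
    have hfrob : chi (ZMod p) pD = (chi (ZMod p) D) ^ p := by
      unfold chi
      rw [sum_pow_char p, Finset.sum_image fun a _ b _ h => hinj h]
      refine Finset.sum_congr rfl fun d _ => ?_
      rw [AddMonoidAlgebra.single_pow, one_pow]
    have hzero : ((D.card - lam : ℕ) : AddMonoidAlgebra (ZMod p) G) = 0 :=
      (CharP.cast_eq_zero_iff _ p _).mpr hpn
    have hT : (chi (ZMod p) D) ^ (p - 1) * whole (ZMod p) = whole (ZMod p) := by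
      rw [mul_whole, aug_pow, aug_chi, ZMod.pow_card_sub_one_eq_one hk0, one_smul]
    have hprod : chi (ZMod p) pD * chiNeg (ZMod p) D =
        (lam : AddMonoidAlgebra (ZMod p) G) * whole (ZMod p) := by
      rw [hfrob, ← pow_sub_one_mul hp.ne_zero, mul_assoc, chi_mul_chiNeg_self hD hle, hzero, zero_add,
        mul_left_comm, hT]
    have hcoef : (chi (ZMod p) pD * chiNeg (ZMod p) D).coeff x =
        ((lam : AddMonoidAlgebra (ZMod p) G) * whole (ZMod p)).coeff x := by rw [hprod]
    rwa [coeff_chi_mul_chiNeg, coeff_natCast_mul, coeff_whole, mul_one] at hcoef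
  -- (2) `E(x) = λ + p R(x)`
  set E : G → ℕ := fun x => repCount pD D x with hE
  set Rf : G → ℕ := fun x => E x / p with hRf
  have hER : ∀ x, E x = p * Rf x + lam := by
    intro x
    have h1 : E x % p = lam := by
      have := (ZMod.natCast_eq_natCast_iff' _ _ _).mp (hmodp x)
      rwa [Nat.mod_eq_of_lt hlam] at this
    have := Nat.div_add_mod (E x) p
    rw [h1] at this
    exact this.symm
  -- (3) `Σ E = k²`
  have hsumE : ∑ x, (E x : ℤ) = (D.card : ℤ) * D.card := by
    have h := aug_mul (R := ℤ) (chi ℤ pD) (chiNeg ℤ D)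
    rw [aug_chi, aug_chiNeg, hpDcard] at h
    unfold aug at h
    simp_rw [coeff_chi_mul_chiNeg] at h
    exact h
  -- (4) `Σ E² = k² + (v-1) λ²` : coefficient at 0 of `E E^(-1) = (χ_D χ_D^(-1)) (χ_{pD} χ_{pD}^(-1))`
  have hsumE2 : ∑ x, (E x : ℤ) * E x =
      (D.card : ℤ) * D.card + (Fintype.card G - 1 : ℕ) * ((lam : ℤ) * lam) := by
    have helt : (chi ℤ pD * chiNeg ℤ D) * (chi ℤ D * chiNeg ℤ pD) =
        (chi ℤ D * chiNeg ℤ D) * (chi ℤ pD * chiNeg ℤ pD) := by ring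
    have h : ((chi ℤ pD * chiNeg ℤ D) * (chi ℤ D * chiNeg ℤ pD)).coeff 0 =
        ((chi ℤ D * chiNeg ℤ D) * (chi ℤ pD * chiNeg ℤ pD)).coeff 0 := by rw [helt]
    rw [coeff_mul_fintype, coeff_mul_fintype] at h
    simp_rw [coeff_chi_mul_chiNeg, zero_sub] at h
    have lhs : ∀ y : G, (repCount pD D y : ℤ) * (repCount D pD (-y) : ℤ) = (E y : ℤ) * E y := by
      intro y
      rw [repCount_swap D pD (-y), neg_neg]
    simp_rw [lhs] at h
    rw [h, ← Finset.sum_erase_add _ _ (mem_univ (0 : G)), repCount_self_zero, neg_zero, repCount_self_zero,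
      hpDcard]
    have : ∀ y ∈ (univ : Finset G).erase 0,
        (repCount D D y : ℤ) * (repCount pD pD (-y) : ℤ) = lam * lam := by
      intro y hy
      have hy0 : y ≠ 0 := Finset.ne_of_mem_erase hy
      unfold repCount
      rw [hD y hy0, hpD_ds (-y) (neg_ne_zero.mpr hy0)]
    rw [Finset.sum_congr rfl this, Finset.sum_const, Finset.card_erase_of_mem (mem_univ _), Finset.card_univ,
      nsmul_eq_mul]
    ring
  -- (5) with `m = Σ R`: `p m = n` and `Σ R² = m²`
  set m : ℕ := ∑ x, Rf x with hm
  have hv1 : 1 ≤ Fintype.card G := Fintype.card_pos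
  have hbasicZ : (lam : ℤ) * ((Fintype.card G : ℤ) - 1) = (D.card : ℤ) * (D.card - 1) := by
    have h' : ((lam * (Fintype.card G - 1) : ℕ) : ℤ) = ((D.card * (D.card - 1) : ℕ) : ℤ) := by
      rw [hD.basic_eq]
    push_cast [Nat.cast_sub hv1, Nat.cast_sub (Nat.one_le_of_lt hn)] at h'
    exact h'
  have hmZ : (∑ x, (Rf x : ℤ)) = m := by rw [hm]; push_cast; rfl
  have hpm : (p : ℤ) * m = D.card - lam := by
    have : ∑ x, (E x : ℤ) = p * m + Fintype.card G * lam := by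
      simp_rw [hER]
      push_cast
      rw [Finset.sum_add_distrib, ← Finset.mul_sum, Finset.sum_const, Finset.card_univ, nsmul_eq_mul, hmZ]
    rw [hsumE] at this
    nlinarith [hbasicZ, this]
  have hsumR2 : ∑ x, (Rf x : ℤ) * Rf x = (m : ℤ) * m := by
    have : ∑ x, (E x : ℤ) * E x =
        Fintype.card G * ((lam : ℤ) * lam) + 2 * lam * (p * m) + (p : ℤ) * p * ∑ x, (Rf x : ℤ) * Rf x := by
      simp_rw [hER]
      push_cast
      have : ∀ x : G, ((p : ℤ) * Rf x + lam) * ((p : ℤ) * Rf x + lam) =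
          (lam : ℤ) * lam + 2 * lam * p * (Rf x : ℤ) + (p : ℤ) * p * ((Rf x : ℤ) * Rf x) := fun x => by ring
      simp_rw [this]
      rw [Finset.sum_add_distrib, Finset.sum_add_distrib, Finset.sum_const, Finset.card_univ, nsmul_eq_mul,
        ← Finset.mul_sum, ← Finset.mul_sum, hmZ]
      ring
    rw [hsumE2] at this
    have hp0 : (p : ℤ) ≠ 0 := by exact_mod_cast hp.ne_zero
    have hv' : ((Fintype.card G - 1 : ℕ) : ℤ) = (Fintype.card G : ℤ) - 1 := by
      push_cast [Nat.cast_sub hv1]; ring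
    rw [hv'] at this
    have key : (p : ℤ) * p * (∑ x, (Rf x : ℤ) * Rf x) = (p : ℤ) * p * ((m : ℤ) * m) := by
      nlinarith [this, hpm]
    exact mul_left_cancel₀ (mul_ne_zero hp0 hp0) key
  -- (6) hence `R` is concentrated at one point `s` with `R s = m > 0`
  have hm0 : 0 < m := by
    have h1 : (0 : ℤ) < p * m := by
      rw [hpm]
      have := hn
      have : (lam : ℤ) < D.card := by exact_mod_cast hn
      linarith
    have hp0 : (0 : ℤ) < p := by exact_mod_cast hp.pos
    have : (0 : ℤ) < m := pos_of_mul_pos_right h1 hp0.le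
    exact_mod_cast this
  have hRle : ∀ x, Rf x ≤ m := fun x => Finset.single_le_sum (fun y _ => Nat.zero_le (Rf y)) (mem_univ x)
  have hterm : ∀ x, (Rf x : ℤ) * (m - Rf x : ℕ) = 0 := by
    have hsum0 : ∑ x, (Rf x : ℤ) * (m - Rf x : ℕ) = 0 := by
      have : ∀ x, (Rf x : ℤ) * (m - Rf x : ℕ) = (m : ℤ) * Rf x - (Rf x : ℤ) * Rf x := by
        intro x; push_cast [Nat.cast_sub (hRle x)]; ring
      simp_rw [this]
      rw [Finset.sum_sub_distrib, ← Finset.mul_sum, hsumR2, hmZ]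
      ring
    have hnn : ∀ x ∈ (univ : Finset G), (0 : ℤ) ≤ (Rf x : ℤ) * (m - Rf x : ℕ) := fun x _ => by positivity
    exact fun x => (Finset.sum_eq_zero_iff_of_nonneg hnn).mp hsum0 x (mem_univ x)
  obtain ⟨s, -, hs⟩ : ∃ s ∈ (univ : Finset G), Rf s ≠ 0 := by
    apply Finset.exists_ne_zero_of_sum_ne_zero
    rw [← hm]; exact hm0.ne'
  have hRs : Rf s = m := by
    have := hterm s
    rcases mul_eq_zero.mp this with h | h
    · exact absurd (by exact_mod_cast h) hs
    · have : m - Rf s = 0 := by exact_mod_cast h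
      have := hRle s
      omega
  -- (7) `E s = k`, so every `b ∈ D` has `s + b ∈ pD`: `D + s = pD`
  have hEs : E s = D.card := by
    have h1 := hER s
    rw [hRs] at h1
    have : (E s : ℤ) = D.card := by push_cast [h1]; linarith [hpm]
    exact_mod_cast this
  have hEs' : (D.filter fun b => s + b ∈ pD).card = D.card := hEs
  have hfilter : (D.filter fun b => s + b ∈ pD) = D :=
    Finset.eq_of_subset_of_card_le (Finset.filter_subset _ _) (by rw [hEs'])
  refine ⟨s, ?_⟩
  symm
  apply Finset.eq_of_subset_of_card_le
  · intro y hy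
    rw [mem_image] at hy
    obtain ⟨b, hb, rfl⟩ := hy
    rw [← hfilter, mem_filter] at hb
    rw [add_comm]; exact hb.2
  · rw [hpDcard, Finset.card_image_of_injective _ (add_left_injective s)]

/-- **A translate with element-sum zero exists when `gcd(k, v) = 1`.** [cite: Lander1983, Thm. 5.10 (proof) p. 254] -/
theorem exists_translate_sum_eq_zero (D : Finset G) (hcop : (D.card).Coprime (Fintype.card G)) :
    ∃ g : G, ∑ x ∈ D.image (fun x => x + g), x = 0 := by
  classical
  -- multiplication by k is a bijection of G
  have hinj : Function.Injective (fun x : G => D.card • x) := by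
    intro a b hab
    have h0 : D.card • (a - b) = 0 := by rw [smul_sub]; exact sub_eq_zero.mpr hab
    have hord : addOrderOf (a - b) ∣ D.card := addOrderOf_dvd_of_nsmul_eq_zero h0
    have hcard : addOrderOf (a - b) ∣ Fintype.card G := addOrderOf_dvd_card
    have h1 : addOrderOf (a - b) = 1 := Nat.eq_one_of_dvd_coprimes hcop hord hcard
    exact sub_eq_zero.mp (AddMonoid.addOrderOf_eq_one_iff.mp h1)
  obtain ⟨g, hg⟩ := (Finite.surjective_of_injective hinj) (-∑ x ∈ D, x)
  refine ⟨g, ?_⟩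
  rw [Finset.sum_image fun a _ b _ h => add_left_injective g h, Finset.sum_add_distrib, Finset.sum_const]
  have hg' : D.card • g = -∑ x ∈ D, x := hg
  rw [hg']; abel

/-- **A numerical multiplier fixes the translate with element-sum zero** (when `gcd(k,v) = 1`): if
`Σ_{x ∈ D} x = 0` and `t·D = D + s` with `x ↦ t·x` injective, then `t·D = D`.
[cite: Lander1983, Thm. 5.10 p. 254] -/
theorem image_nsmul_eq_self_of_sum_eq_zero (D : Finset G) (hcop : (D.card).Coprime (Fintype.card G))
    (hsum : ∑ x ∈ D, x = 0) {t : ℕ} (hinj : Function.Injective (fun x : G => t • x)) {s : G}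
    (h : D.image (fun x => t • x) = D.image (fun x => x + s)) : D.image (fun x => t • x) = D := by
  classical
  have h1 : ∑ x ∈ D.image (fun x => t • x), x = 0 := by
    rw [Finset.sum_image fun a _ b _ hab => hinj hab, ← Finset.smul_sum, hsum, smul_zero]
  have h2 : ∑ x ∈ D.image (fun x => x + s), x = D.card • s := by
    rw [Finset.sum_image fun a _ b _ hab => add_left_injective s hab, Finset.sum_add_distrib, hsum,
      Finset.sum_const, zero_add]
  rw [h] at h1
  rw [h1] at h2
  -- `k • s = 0` with `gcd(k, v) = 1` forces `s = 0`
  have hs : s = 0 := by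
    have hord : addOrderOf s ∣ D.card := addOrderOf_dvd_of_nsmul_eq_zero h2.symm
    have hcard : addOrderOf s ∣ Fintype.card G := addOrderOf_dvd_card
    exact AddMonoid.addOrderOf_eq_one_iff.mp (Nat.eq_one_of_dvd_coprimes hcop hord hcard)
  rw [h, hs]
  simp

end IsDifferenceSet

end Literature.Combinatorics.Designs.DifferenceSets
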